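import Mathlib
import Literature.Computability.AlgebraicComplexity.PrattTrapezoidVal
import Literature.Computability.AlgebraicComplexity.PrattTrapezoidValBounds
import Summits.MatrixMultiplication.MatrixMultiplication.Theorems.EisensteinValCertificatesPrimeValSavingPointwiseLoads
import Summits.MatrixMultiplication.MatrixMultiplication.Theorems.EisensteinValCertificatesPrimeValSavingDisjointSquares

/-!
# The constant in Pratt's Prop. 3.4: `Val(G) ≤ |G|^{3/2}/(2√2) + (3/2)|G|`

Support file for route `MatrixMultiplication/EisensteinValCertificates` (cruxes
`stmt-MatrixMultiplication-7788` `PrimeValSaving`, stmt-7790 `PrimeFourThirdsSaving`), third of the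
series `…PointwiseLoads` / `…DisjointSquares`.  Pratt (arXiv:2309.03878) proves
`|G| ≤ Val(G) ≤ |G|^{3/2}` (Prop. 3.4, from the hypergraph bound Prop. 3.1, attained by the
matrix-multiplication hypergraph `M_n`) and `Val(G) = o(|G|^{3/2})` (Prop. 3.7, by arithmetic removal,
ineffective).  Here an explicit constant is taken off: for every finite abelian group `G` of order `N`,

* `pow_five_le` : a trapezoid-free triple with `T` solutions has `8 T⁵ ≤ N³ (T + N)³`;
* `prattVal_pow_five_le`, `prattVal_sq_le_of_le` (`Val ≥ kN ⇒ 8k³ Val² ≤ (k+1)³ N³`);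
* `prattVal_le_sqrt` : `Val(G) ≤ N √(N/8) + (3/2) N`, i.e. `prattVal_le_rpow` :
  `Val(G) ≤ N^{3/2} / (2√2) + (3/2) N`;
* `card_filter_notMem_add_le` : the near-periodicity of `B` under differences of `C`-lines in the
  dense regime (`|B \ (B + c' - c)| ≤ r(c) + r(c') + N − #A − #B`), the structural reason the constant
  is not attained at prime modulus (Pollard) — recorded for the crux owners, pure counting.

The input beyond Prop. 3.1 (`T² ≤ #A·#B·#C`, tree theorem
`IsEquilateralTrapezoidFree.card_zeroSumTriples_sq_le`) is GROUP-THEORETIC and false for `M_n`: every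
`C`-line carries at least `#A + #B − N` points (its `A`-set is `A ∩ (−c − B)`), so
`(#A + #B)·T ≤ N·T + #A·#B` (`PrattValDisjointSquares.card_mul_le_of_dense`) and its two rotations;
these force the three sets down to density `1/2 + O(N/T)` each, and `T² ≤ #A#B#C ≤ (N/2 + O(N²/T))³`
gives the constant `2^{-3/2}`.  (AM–GM step: `8uvw ≤ (u+v)(v+w)(w+u)`.)
[cite: Pratt2024, Prop. 3.1, Prop. 3.4, Prop. 3.6, Prop. 3.7]
-/

-- single-conjunct summit: the mandated namespace repeats `MatrixMultiplication`.
set_option linter.dupNamespace false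

namespace Summit.MatrixMultiplication.MatrixMultiplication.Theorems

namespace PrattValConstant

open Finset Literature.Computability.AlgebraicComplexity PrattValPointwiseLoads PrattValDisjointSquares

variable {G : Type*} [AddCommGroup G] [DecidableEq G] {A B C : Finset G}

/-! ### Rotation invariance of the count -/

/-- The number of solutions is invariant under the cyclic permutation `(A, B, C) ↦ (B, C, A)`
(abelian groups). [cite: Pratt2024, Prop. 3.6] -/
theorem card_zeroSumTriples_rotate (A B C : Finset G) :
    #(zeroSumTriples B C A) = #(zeroSumTriples A B C) := by
  refine card_bij' (fun t _ => (t.2.2, t.1, t.2.1)) (fun t _ => (t.2.1, t.2.2, t.1)) ?_ ?_ ?_ ?_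
  · intro t ht
    obtain ⟨⟨hb, hc, ha⟩, hsum⟩ := mem_zeroSumTriples.1 ht
    exact mem_zeroSumTriples.2 ⟨⟨ha, hb, hc⟩, by rw [← hsum]; abel⟩
  · intro t ht
    obtain ⟨⟨ha, hb, hc⟩, hsum⟩ := mem_zeroSumTriples.1 ht
    exact mem_zeroSumTriples.2 ⟨⟨hb, hc, ha⟩, by rw [← hsum]; abel⟩
  · intro t _; rfl
  · intro t _; rfl

/-! ### The constant in Prop. 3.4: `Val(G) ≤ (2√2)⁻¹ |G|^{3/2} + O(|G|)` -/

/-- **Fifth-power inequality.** For a trapezoid-free triple in a finite abelian group of order `N`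
with `T` solutions: `8 T⁵ ≤ N³ (T + N)³`.  Proof: `T² ≤ #A·#B·#C` (Prop. 3.1) and, for each of the
three pairs, `(#X + #Y)·T ≤ N·T + N²` (dense pairs); with `u = T·#A`, `v = T·#B`, `w = T·#C` and
`S = N(T+N)` this reads `u+v, v+w, w+u ≤ S`, whence `8·T³·#A#B#C = 8uvw ≤ (u+v)(v+w)(w+u) ≤ S³`.
The inequality is GROUP-THEORETIC: the matrix-multiplication hypergraph `M_n` (parts of size
`N = n²`, `T = n³`, Pratt Prop. 3.1's extremal example) violates it. [cite: Pratt2024, Prop. 3.1, 3.4] -/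
theorem pow_five_le [Fintype G] (h : IsEquilateralTrapezoidFree A B C) :
    8 * #(zeroSumTriples A B C) ^ 5 ≤
      Fintype.card G ^ 3 * (#(zeroSumTriples A B C) + Fintype.card G) ^ 3 := by
  set T := #(zeroSumTriples A B C) with hT
  set N := Fintype.card G with hN
  have hI0 : T ^ 2 ≤ #A * #B * #C := h.card_zeroSumTriples_sq_le
  have hA : #A ≤ N := card_le_univ _
  have hB : #B ≤ N := card_le_univ _
  have hC : #C ≤ N := card_le_univ _
  have hI1 : (#A + #B) * T ≤ N * T + N * N :=
    (card_mul_le_of_dense h).trans (Nat.add_le_add_left (Nat.mul_le_mul hA hB) _)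
  have hI2 : (#B + #C) * T ≤ N * T + N * N := by
    have h' := card_mul_le_of_dense (rotate h)
    rw [card_zeroSumTriples_rotate] at h'
    exact h'.trans (Nat.add_le_add_left (Nat.mul_le_mul hB hC) _)
  have hI3 : (#C + #A) * T ≤ N * T + N * N := by
    have h' := card_mul_le_of_dense (rotate (rotate h))
    rw [card_zeroSumTriples_rotate, card_zeroSumTriples_rotate] at h'
    exact h'.trans (Nat.add_le_add_left (Nat.mul_le_mul hC hA) _)
  -- `u + v ≤ S`, `v + w ≤ S`, `w + u ≤ S`
  set S := N * T + N * N with hS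
  have huv : T * #A + T * #B ≤ S := by rw [← mul_add, mul_comm]; exact hI1
  have hvw : T * #B + T * #C ≤ S := by rw [← mul_add, mul_comm]; exact hI2
  have hwu : T * #C + T * #A ≤ S := by rw [← mul_add, mul_comm]; exact hI3
  have hAMGM : 8 * ((T * #A) * (T * #B) * (T * #C)) ≤
      (T * #A + T * #B) * ((T * #B + T * #C) * (T * #C + T * #A)) := by
    have key : ∀ u v w : ℕ, 8 * (u * v * w) ≤ (u + v) * ((v + w) * (w + u)) := by
      intro u v w
      have : (8 * (u * v * w) : ℤ) ≤ ((u + v) * ((v + w) * (w + u)) : ℤ) := by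
        nlinarith [mul_nonneg (Int.natCast_nonneg u) (sq_nonneg ((v : ℤ) - w)),
          mul_nonneg (Int.natCast_nonneg v) (sq_nonneg ((w : ℤ) - u)),
          mul_nonneg (Int.natCast_nonneg w) (sq_nonneg ((u : ℤ) - v))]
      exact_mod_cast this
    exact key _ _ _
  have hprod : (T * #A + T * #B) * ((T * #B + T * #C) * (T * #C + T * #A)) ≤ S * (S * S) :=
    Nat.mul_le_mul huv (Nat.mul_le_mul hvw hwu)
  calc 8 * T ^ 5 = 8 * (T ^ 3 * T ^ 2) := by ring
    _ ≤ 8 * (T ^ 3 * (#A * #B * #C)) := Nat.mul_le_mul_left _ (Nat.mul_le_mul_left _ hI0)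
    _ = 8 * ((T * #A) * (T * #B) * (T * #C)) := by ring
    _ ≤ S * (S * S) := hAMGM.trans hprod
    _ = N ^ 3 * (T + N) ^ 3 := by rw [hS]; ring

/-- **Fifth-power inequality for `Val`**: `8·Val(G)⁵ ≤ |G|³ (Val(G) + |G|)³` for every finite
abelian group `G`. [cite: Pratt2024, Prop. 3.4] -/
theorem prattVal_pow_five_le (G : Type*) [AddCommGroup G] [DecidableEq G] [Fintype G] :
    8 * prattVal G ^ 5 ≤ Fintype.card G ^ 3 * (prattVal G + Fintype.card G) ^ 3 := by
  obtain ⟨A, B, C, h, hk⟩ := exists_prattVal_eq (G := G)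
  rw [← hk]
  exact pow_five_le h

/-- If `Val(G) ≥ k·|G|` then `8 k³ · Val(G)² ≤ (k+1)³ · |G|³`; for `k = 1` (always available, Prop. 3.4
lower bound) this is `Val(G)² ≤ |G|³`, and as `k → ∞` the constant tends to `1/8`.
[cite: Pratt2024, Prop. 3.4] -/
theorem prattVal_sq_le_of_le (G : Type*) [AddCommGroup G] [DecidableEq G] [Fintype G] (k : ℕ)
    (hk : k * Fintype.card G ≤ prattVal G) :
    8 * k ^ 3 * prattVal G ^ 2 ≤ (k + 1) ^ 3 * Fintype.card G ^ 3 := by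
  set V := prattVal G with hV
  set N := Fintype.card G with hN
  have h5 : 8 * V ^ 5 ≤ N ^ 3 * (V + N) ^ 3 := prattVal_pow_five_le G
  -- `k (V + N) ≤ (k+1) V`, hence `k³ (V+N)³ ≤ (k+1)³ V³`
  have h1 : k * (V + N) ≤ (k + 1) * V := by nlinarith
  have h2 : k ^ 3 * (V + N) ^ 3 ≤ (k + 1) ^ 3 * V ^ 3 := by
    rw [← mul_pow, ← mul_pow]; exact Nat.pow_le_pow_left h1 3
  rcases Nat.eq_zero_or_pos V with hV0 | hVpos
  · simp [hV0]
  · have key : 8 * k ^ 3 * V ^ 2 * V ^ 3 ≤ (k + 1) ^ 3 * N ^ 3 * V ^ 3 := by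
      calc 8 * k ^ 3 * V ^ 2 * V ^ 3 = k ^ 3 * (8 * V ^ 5) := by ring
        _ ≤ k ^ 3 * (N ^ 3 * (V + N) ^ 3) := Nat.mul_le_mul_left _ h5
        _ = N ^ 3 * (k ^ 3 * (V + N) ^ 3) := by ring
        _ ≤ N ^ 3 * ((k + 1) ^ 3 * V ^ 3) := Nat.mul_le_mul_left _ h2
        _ = (k + 1) ^ 3 * N ^ 3 * V ^ 3 := by ring
    exact Nat.le_of_mul_le_mul_right key (pow_pos hVpos 3)

/-- **Pratt's Prop. 3.4 with constant `2^{-3/2}`** (square-root form): for every finite abelian group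
`G` of order `N`, `Val(G) ≤ N·√(N/8) + (3/2)·N`.  (Prop. 3.4 states `Val(G) ≤ N^{3/2}`; Prop. 3.7 gives
`o(N^{3/2})` ineffectively, via arithmetic removal.) [cite: Pratt2024, Prop. 3.4, Prop. 3.7] -/
theorem prattVal_le_sqrt (G : Type*) [AddCommGroup G] [DecidableEq G] [Fintype G] :
    (prattVal G : ℝ) ≤ Fintype.card G * Real.sqrt (Fintype.card G / 8) + 3 / 2 * Fintype.card G := by
  have h5 := prattVal_pow_five_le G
  have hVN : Fintype.card G ≤ prattVal G := card_le_prattVal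
  set V : ℝ := (prattVal G : ℝ) with hV
  set N : ℝ := (Fintype.card G : ℝ) with hN
  have hNpos : 0 < N := by
    rw [hN]; exact_mod_cast Fintype.card_pos
  have h5R : 8 * V ^ 5 ≤ N ^ 3 * (V + N) ^ 3 := by
    rw [hV, hN]; exact_mod_cast h5
  have hVNR : N ≤ V := by rw [hV, hN]; exact_mod_cast hVN
  have hsqrt_nonneg : 0 ≤ Real.sqrt (N / 8) := Real.sqrt_nonneg _
  -- `k := V / N ≥ 1`
  set k : ℝ := V / N with hk
  have hVk : V = k * N := by rw [hk]; field_simp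
  have hk1 : 1 ≤ k := by rw [hk, le_div_iff₀ hNpos, one_mul]; exact hVNR
  by_cases hk32 : k ≤ 3 / 2
  · calc V = k * N := hVk
      _ ≤ 3 / 2 * N := mul_le_mul_of_nonneg_right hk32 hNpos.le
      _ ≤ N * Real.sqrt (N / 8) + 3 / 2 * N := le_add_of_nonneg_left (by positivity)
  · rw [not_le] at hk32
    -- from `8 V⁵ ≤ N³ (V+N)³` and `V = k N`: `8 k⁵ ≤ N (k+1)³`
    have h8 : 8 * k ^ 5 ≤ N * (k + 1) ^ 3 := by
      have h' : 8 * k ^ 5 * N ^ 5 ≤ N * (k + 1) ^ 3 * N ^ 5 := by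
        have := h5R; rw [hVk] at this; nlinarith [this]
      exact le_of_mul_le_mul_right h' (by positivity)
    -- polynomial fact: `(k+1)³ (k - 3/2)² ≤ k⁵` for `k ≥ 3/2`
    have hP : (k + 1) ^ 3 * (k - 3 / 2) ^ 2 ≤ k ^ 5 := by
      nlinarith [mul_pos (by linarith : (0:ℝ) < k) (mul_pos (by linarith : (0:ℝ) < k)
        (by linarith : (0:ℝ) < k)), hk32]
    have hk1pos : 0 < (k + 1) ^ 3 := by positivity
    have h9 : 8 * (k - 3 / 2) ^ 2 ≤ N := by
      have : 8 * (k - 3 / 2) ^ 2 * (k + 1) ^ 3 ≤ N * (k + 1) ^ 3 := by nlinarith [h8, hP]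
      exact le_of_mul_le_mul_right this hk1pos
    have h10 : k - 3 / 2 ≤ Real.sqrt (N / 8) := Real.le_sqrt_of_sq_le (by linarith)
    calc V = (k - 3 / 2) * N + 3 / 2 * N := by rw [hVk]; ring
      _ ≤ Real.sqrt (N / 8) * N + 3 / 2 * N := by
          have := mul_le_mul_of_nonneg_right h10 hNpos.le
          linarith
      _ = N * Real.sqrt (N / 8) + 3 / 2 * N := by ring

/-- **Pratt's Prop. 3.4 with constant `2^{-3/2}`**: `Val(G) ≤ |G|^{3/2} / (2√2) + (3/2)|G|` for every
finite abelian group `G` — the group-theoretic inequalities `(#X + #Y)·T ≤ |G|·T + #X·#Y` cut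
the three sets down to density `≤ 1/2 + o(1)` each, and `T² ≤ #A·#B·#C` does the rest.
[cite: Pratt2024, Prop. 3.4, Prop. 3.7] -/
theorem prattVal_le_rpow (G : Type*) [AddCommGroup G] [DecidableEq G] [Fintype G] :
    (prattVal G : ℝ) ≤
      (Fintype.card G : ℝ) ^ ((3 : ℝ) / 2) / (2 * Real.sqrt 2) + 3 / 2 * Fintype.card G := by
  have h := prattVal_le_sqrt G
  have hN : (0 : ℝ) ≤ Fintype.card G := Nat.cast_nonneg _
  have key : (Fintype.card G : ℝ) * Real.sqrt (Fintype.card G / 8) =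
      (Fintype.card G : ℝ) ^ ((3 : ℝ) / 2) / (2 * Real.sqrt 2) := by
    have h8 : Real.sqrt 8 = 2 * Real.sqrt 2 := by
      rw [show (8 : ℝ) = 2 ^ 2 * 2 by norm_num, Real.sqrt_mul (by positivity), Real.sqrt_sq (by norm_num)]
    rw [Real.sqrt_div hN, h8, show ((3 : ℝ) / 2) = 1 + 1 / 2 by norm_num,
      Real.rpow_add' hN (by norm_num), Real.rpow_one, ← Real.sqrt_eq_rpow]
    ring
  rw [← key]
  exact h



/-! ### Near-periodicity in the dense regime -/

/-- **Near-periodicity (dense regime).** For any `A, B` in a finite abelian group of order `N` and any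
`c, c'`: `#{b ∈ B : b + c - c' ∉ B} + #A + #B ≤ r_B(c) + r_B(c') + N`, where
`r_B(c) = #{b ∈ B : -(b+c) ∈ A}` is the load of the `C`-line `c`; i.e.
`|B \ (B + (c' - c))| ≤ r(c) + r(c') + (N - #A - #B)` — both `B + c` and `B + c'` are within `r` of
the complement of `-A`.  Pure counting, no trapezoid-freeness needed.  Meaning for `PrimeValSaving`:
in the regime where the constant `2^{-3/2}` of `prattVal_le_rpow` would be attained (`#A + #B`
close to `N`, loads `≈ √N`), `B` is almost invariant under every difference of two `C`-lines, so the
additive energy `E(B, C)` is nearly maximal — impossible at prime modulus by Pollard's theorem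
(sum sets of non-progressions grow); this is the cheapest place where primality enters.
[folklore] -/
theorem card_filter_notMem_add_le [Fintype G] (A B : Finset G) (c c' : G) :
    #(B.filter fun b => b + c - c' ∉ B) + #A + #B ≤
      #(B.filter fun b => -(b + c) ∈ A) + #(B.filter fun b => -(b + c') ∈ A) + Fintype.card G := by
  set L := B.filter fun b => b + c - c' ∉ B with hL
  set L₁ := L.filter fun b => -(b + c) ∈ A with hL₁
  set L₂ := L.filter fun b => ¬ (-(b + c) ∈ A) with hL₂
  set F := (univ : Finset G).filter fun y => -(y + c') ∈ A with hF
  set U := (univ : Finset G) \ (B ∪ F) with hU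
  have hsplit : #L = #L₁ + #L₂ := by
    rw [hL₁, hL₂]; exact (card_filter_add_card_filter_not _).symm
  have h1 : #L₁ ≤ #(B.filter fun b => -(b + c) ∈ A) := by
    refine card_le_card fun b hb => ?_
    simp only [hL₁, hL, mem_filter] at hb ⊢
    exact ⟨hb.1.1, hb.2⟩
  have h2 : #L₂ ≤ #U := by
    refine card_le_card_of_injOn (fun b => b + c - c') ?_ ?_
    · intro b hb
      have hb' := mem_filter.1 (mem_coe.1 hb)
      have hbL := mem_filter.1 hb'.1
      refine mem_coe.2 (mem_sdiff.2 ⟨mem_univ _, ?_⟩)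
      rw [mem_union, not_or]
      refine ⟨hbL.2, ?_⟩
      rw [hF, mem_filter, not_and]
      intro _
      have : -(b + c - c' + c') = -(b + c) := by abel
      rw [this]; exact hb'.2
    · intro b₁ _ b₂ _ h
      simpa using h
  have hF_card : #F = #A := by
    refine card_bij' (fun y _ => -(y + c')) (fun a _ => -(a + c')) ?_ ?_ ?_ ?_
    · intro y hy; exact (mem_filter.1 hy).2
    · intro a ha
      refine mem_filter.2 ⟨mem_univ _, ?_⟩
      have : -(-(a + c') + c') = a := by abel
      rw [this]; exact ha
    · intro y _; abel
    · intro a _; abel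
  have hBF : B ∩ F = B.filter fun b => -(b + c') ∈ A := by
    ext b; simp [hF]
  have hU_card : #U + #(B ∪ F) = Fintype.card G := by
    rw [hU, card_univ_sdiff, Nat.sub_add_cancel (card_le_univ _)]
  have hunion : #(B ∪ F) + #(B.filter fun b => -(b + c') ∈ A) = #B + #A := by
    rw [← hBF, card_union_add_card_inter, hF_card]
  have h12 : #L ≤ #(B.filter fun b => -(b + c) ∈ A) + #U := by
    rw [hsplit]; exact add_le_add h1 h2
  omega

end PrattValConstant

end Summit.MatrixMultiplication.MatrixMultiplication.Theorems
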